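import Literature.IUT.HodgeTheaters.PuncturedEllipticDihedralProfiniteModelDatum
import Literature.IUT.HodgeTheaters.PuncturedEllipticGeomOriginIota
import HarnessLib

/-!
# [IUTchI] §1: the DIHEDRAL PROFINITE MODEL — part 3: the origin record `GeomOriginIota` (free profinite `Δ_X` on
# `a, b`, commutator cusps, torsion-generated `Δ_C`, the involution `ι = η(σ)`) at the datum

Mochizuki, *Inter-universal Teichmüller theory I: construction of Hodge theaters*, kurims manuscript (May 2020),
§1 p. 37 ("`X` … a once-punctured elliptic curve … `C` … the quotient of `X` by the unique `k`-involution `−1`")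
[cite: Mochizuki2012, IUTchI §1 p.37] (D-0012 claim key; series status DISPUTED — nothing of the series is asserted
here); A. Grothendieck, SGA 1 Exp. XIII Cor. 2.12; S. Mochizuki, *Topics in Absolute Anabelian Geometry I*,
Lemma 4.5 (i) p. 54 [cite: MochizukiAbsTopI2012, Lemma 4.5 (i) p.54]; L. Ribes, P. Zalesskii, *Profinite Groups*,
Prop. 3.2.2 [cite: RibesZalesskii2010, Prop 3.2.2].

Cell abc-iut, seat abc-iut-L5-t1 gen 12, L5 ROWS #7 R48 residual «NV-JOINT» (sequel of parts 1–2).  CONTENTS: §1 the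
geometric subgroup `Δ_X = Π_X ∩ Δ_C` of the datum (`= Π_X`, as `G_k = 1`) and the corestriction `j : F₂ → Δ_X` of
`η`, FREE PROFINITE on `j a, j b` by abc-iut-L4-t15's `isFreeProOn_codRestrict` (`η⁻¹(Π_X) = F₂`,
`eta_mem_PiXW_iff`); §2 **`DihedralProfiniteModel.geomOriginIota l h5 : (datum l h5).GeomOriginIota`** — (A) free
profinite; (c′) `I_i = η(a^{sec i}) ⟨[ηa, ηb]⟩⁻ η(a^{sec i})⁻¹` on the nose; (e) `Δ_C = Ŵ` is the closure of `η(W)` and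
`W = ⟨σ, aσ, bσ⟩` is generated by three involutions (abc-iut-L4-t15's `closure_three_eq_top`,
`isOfFinOrder_three`); (i) `ι := η(σ) ∈ Δ_C ∖ Π_X`, `ι² = 1`, `ι (ηa) ι⁻¹ = (ηa)⁻¹`, `ι (ηb) ι⁻¹ = (ηb)⁻¹`
(`SemidirectProduct.inl_aut`).

HONEST LABEL: a group-theoretic model (profinite completion of the topological orbifold group of `C` with its
dihedral covering tower), not the étale `π₁` of a `k`-scheme; the record is INHABITED here, nothing more; no
instance, no notation, no `Prop`-valued definition; nothing here bears on [IUTchIII] Cor. 3.12 or asserts that abc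
is proved or refuted; inhabited ≠ endorsed; no side taken.
-/

noncomputable section

open CategoryTheory Topology ProfiniteGrp DihedralGroup

namespace Literature.IUT.HodgeTheaters

namespace PuncturedEllipticData

namespace DihedralProfiniteModel

open Literature.AnabelianGeometry.AbsoluteAnabelian Literature.IUT.HodgeTheaters.ProfiniteCompletion
  Literature.IUT.HodgeTheaters.GeomOriginProfiniteModel

variable (l : ℕ) [Fact l.Prime]

/-! ### §1. `Δ_X = Π_X ∩ Δ_C` and the corestriction `j : F₂ → Δ_X` -/

/-- `Δ_X := Π_X ∩ Δ_C` of the datum (as a subgroup of `Ŵ`; equal to `Π_X` since `G_k = 1`).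
[cite: Mochizuki2012, IUTchI §1 p.37] -/
abbrev DeltaXW : Subgroup (profiniteCompletion W) := PiXW l ⊓ ext.geom

/-- `Δ_X = Π_X`. [cite: Mochizuki2012, IUTchI §1 p.37] -/
theorem deltaXW_eq : DeltaXW l = PiXW l := by
  rw [DeltaXW, ext_geom_eq_top, inf_top_eq]

/-- `η(w) ∈ Δ_X ↔ w ∈ F₂`. [cite: Mochizuki2012, IUTchI §1 p.37] -/
theorem eta_mem_deltaXW_iff (w : W) :
    toCompletion W w ∈ DeltaXW l ↔ w ∈ (SemidirectProduct.inl : FreeGroup (Fin 2) →* W).range := by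
  rw [deltaXW_eq, eta_mem_PiXW_iff]

/-- `η(inl x) ∈ Δ_X`. [cite: Mochizuki2012, IUTchI §1 p.37] -/
theorem eta_inl_mem_deltaXW (x : FreeGroup (Fin 2)) :
    (toCompletion W).comp SemidirectProduct.inl x ∈ DeltaXW l :=
  (eta_mem_deltaXW_iff l _).2 ⟨x, rfl⟩

/-- `Δ_X` is open. [cite: Mochizuki2012, IUTchI §1 p.37] -/
theorem isOpen_deltaXW : IsOpen (DeltaXW l : Set (profiniteCompletion W)) := by
  rw [deltaXW_eq]; exact isOpen_PiXW l

/-- **The corestriction `j : F₂ → Δ_X`, `x ↦ η(inl x)`.** [cite: Mochizuki2012, IUTchI §1 p.37] -/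
def jX : FreeGroup (Fin 2) →* ↥(DeltaXW l) :=
  ((toCompletion W).comp SemidirectProduct.inl).codRestrict (DeltaXW l) (eta_inl_mem_deltaXW l)

/-- `(j x : Ŵ) = η(inl x)`. [cite: Mochizuki2012, IUTchI §1 p.37] -/
@[simp] theorem coe_jX (x : FreeGroup (Fin 2)) :
    (jX l x : profiniteCompletion W) = toCompletion W (SemidirectProduct.inl x) := rfl

/-- **The two topological generators `η a, η b` of `Δ_X`.** [cite: Mochizuki2012, IUTchI §1 p.37] -/
def gensW : Fin 2 → ↥(DeltaXW l) := fun i => jX l (FreeGroup.of i)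

/-- `(gens 0 : Ŵ) = η a`. [cite: Mochizuki2012, IUTchI §1 p.37] -/
@[simp] theorem coe_gensW_zero : (gensW l 0 : profiniteCompletion W) = toCompletion W (SemidirectProduct.inl ga) :=
  rfl

/-- `(gens 1 : Ŵ) = η b`. [cite: Mochizuki2012, IUTchI §1 p.37] -/
@[simp] theorem coe_gensW_one : (gensW l 1 : profiniteCompletion W) = toCompletion W (SemidirectProduct.inl gb) :=
  rfl

/-- **(A) `Δ_X` is FREE PROFINITE on `η a, η b`**: `η⁻¹(Δ_X) = F₂ ⊴ W` has index `2`, so the corestriction of `η` to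
`F₂ → Δ_X` is a pro-`𝔓𝔯𝔦𝔪𝔢𝔰` completion (abc-iut-L4-t15's `isFreeProOn_codRestrict`), and free pro-`𝔓𝔯𝔦𝔪𝔢𝔰` = free
pro-`Set.univ` (`isFreeProOn_univ_of_prime`). [cite: MochizukiAbsTopI2012, Lemma 4.5 (i) p.54] -/
theorem isFreeProOn_gensW : IsFreeProOn ↥(DeltaXW l) Set.univ (gensW l) := by
  haveI := normal_range_inl invAct
  haveI : (SemidirectProduct.inl : FreeGroup (Fin 2) →* W).range.FiniteIndex :=
    ⟨by rw [index_range_inl invAct]; norm_num⟩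
  exact isFreeProOn_univ_of_prime (isFreeProOn_codRestrict SemidirectProduct.inl SemidirectProduct.inl_injective
    (DeltaXW l) (isOpen_deltaXW l) (eta_mem_deltaXW_iff l) (eta_inl_mem_deltaXW l))

/-- `η(γ_n) = η(aⁿ) · [η a, η b] · η(aⁿ)⁻¹` in `Ŵ`. [cite: Mochizuki2012, IUTchI §1 p.37] -/
theorem eta_inl_γ (n : ℤ) : toCompletion W (SemidirectProduct.inl (γ n)) =
    toCompletion W (SemidirectProduct.inl (ga ^ n)) *
      (toCompletion W (SemidirectProduct.inl ga) * toCompletion W (SemidirectProduct.inl gb) *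
        (toCompletion W (SemidirectProduct.inl ga))⁻¹ * (toCompletion W (SemidirectProduct.inl gb))⁻¹) *
      (toCompletion W (SemidirectProduct.inl (ga ^ n)))⁻¹ := by
  simp only [γ, map_mul, map_inv, map_zpow, zpow_neg]

/-! ### §2. The record `GeomOriginIota` at the datum -/

/-- **`GeomOriginIota` is INHABITED at the dihedral profinite datum**: (A) `Δ_X = F̂₂` free profinite on `η a, η b`;
(c′) `I_i = η(a^{sec i})·⟨[ηa, ηb]⟩⁻·η(a^{sec i})⁻¹`; (e) `Δ_C = Ŵ = ⟨η σ, η(aσ), η(bσ)⟩⁻` torsion-generated; (i)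
`ι := η σ ∈ Δ_C ∖ Π_X` with `ι² = 1`, `ι (ηa) ι⁻¹ = (ηa)⁻¹`, `ι (ηb) ι⁻¹ = (ηb)⁻¹`. [cite: Mochizuki2012, IUTchI §1 p.37] -/
def geomOriginIota (h5 : 5 ≤ l) : (datum l h5).GeomOriginIota where
  gens := gensW l
  isFreeProOn := isFreeProOn_gensW l
  inertia_eq_conj_commutator := by
    intro x
    refine ⟨toCompletion W (SemidirectProduct.inl (ga ^ sec l x)), eta_inl_mem_deltaXW l _, ?_⟩
    rw [datum_inertia, decompW]
    congr 2
    exact eta_inl_γ _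
  deltaC_le_closure_torsion := by
    have hD : (datum l h5).DeltaC = ⊤ := ext_geom_eq_top
    rw [hD]
    intro y _
    have hd : DenseRange (toCompletion W) := ProfiniteGrp.ProfiniteCompletion.denseRange (GrpCat.of _)
    have hy : y ∈ closure (Set.range (toCompletion W)) := by rw [hd.closure_range]; trivial
    refine (Subgroup.isClosed_topologicalClosure _).closure_subset_iff.mpr ?_ hy
    rintro _ ⟨w, rfl⟩
    have hw : w ∈ Subgroup.closure ({SemidirectProduct.inr (Multiplicative.ofAdd 1),
        SemidirectProduct.inl (FreeGroup.of 0) * SemidirectProduct.inr (Multiplicative.ofAdd 1),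
        SemidirectProduct.inl (FreeGroup.of 1) * SemidirectProduct.inr (Multiplicative.ofAdd 1)} : Set W) := by
      rw [closure_three_eq_top]; trivial
    refine Subgroup.le_topologicalClosure _ ?_
    have hmap := Subgroup.mem_map_of_mem (toCompletion W) hw
    rw [MonoidHom.map_closure] at hmap
    refine Subgroup.closure_mono ?_ hmap
    rintro _ ⟨s, hs, rfl⟩
    exact ⟨Subgroup.mem_top _, (toCompletion W).isOfFinOrder (isOfFinOrder_three invAct invAct_of s hs)⟩
  iota := toCompletion W (SemidirectProduct.inr gσ)
  iota_mem_deltaC := by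
    have hD : (datum l h5).DeltaC = ⊤ := ext_geom_eq_top
    rw [hD]; trivial
  iota_not_mem_piX := by
    change toCompletion W (SemidirectProduct.inr gσ) ∉ PiXW l
    rw [eta_mem_PiXW_iff, SemidirectProduct.range_inl_eq_ker_rightHom, MonoidHom.mem_ker,
      SemidirectProduct.rightHom_inr]
    decide
  iota_mul_self := by
    rw [← map_mul, ← map_mul, show gσ * gσ = 1 by decide, map_one, map_one]
  iota_conj_gens := by
    intro i
    have hi : (gensW l i : profiniteCompletion W) = toCompletion W (SemidirectProduct.inl (FreeGroup.of i)) := rfl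
    rw [hi, ← map_inv, ← map_mul, ← map_mul, ← map_inv, ← SemidirectProduct.inl_aut, invAct_of, map_inv, map_inv]

/-- **`GeomOriginIota` (hence `GeomOrigin`) is inhabited at the datum.** [cite: Mochizuki2012, IUTchI §1 p.37] -/
theorem nonempty_geomOriginIota (h5 : 5 ≤ l) : Nonempty (datum l h5).GeomOriginIota :=
  ⟨geomOriginIota l h5⟩

/-- The record's generators are `η a, η b` (by `rfl`). [cite: Mochizuki2012, IUTchI §1 p.37] -/
theorem geomOriginIota_gens (h5 : 5 ≤ l) : (geomOriginIota l h5).gens = gensW l := rfl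

/-- The record's involution is `η σ` (by `rfl`). [cite: Mochizuki2012, IUTchI §1 p.37] -/
theorem geomOriginIota_iota (h5 : 5 ≤ l) :
    (geomOriginIota l h5).iota = toCompletion W (SemidirectProduct.inr gσ) := rfl

end DihedralProfiniteModel

end PuncturedEllipticData

end Literature.IUT.HodgeTheaters

end
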